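import Literature.NumberTheory.EllipticCurves.HeegnerPointsKolyvaginPrimaryRamifiedProofs
import HarnessLib

/-!
# Route `GenusKolyvaginAtTwo`, crux L_T `PowDvdShaCardAtTwoRT` (stmt-BirchSwinnertonDyer-23242), LINE 18 stub L, bottom rung
# (index-`≥ 2` engine), input (iii) FROM THE REDUCTION DATUM: at an own prime of extra depth, the value of Kolyvagin's class at
# the Frobenius of `K_λ` is a multiple of its tame value — McCallum Prop. 4.4 (1) at every `p`, «`ℓ(ℓ+1)/2`» displayed

Seat `bsd-line-gk2-p3` g21 (PROVER seat 3/3, cell `bsd-f1-sign2`), `--supports 23242 --as helper`.  THEOREMS ONLY (abstract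
`KolyvaginCocycle` shell of `HeegnerPointsKolyvaginPrimaryClassesProofs`, the reduction-datum style of gk2-p2 g5's
`…KolyvaginRelationAtTwoCharpoly/Orders`).  BSD is NOT proved by any of this; neither is the crux nor stub L.

WHY.  Input (iii) of the deep-own-prime term (this seat's (iii)-socket `…RTHalfTransverseOfValues.halfTransverse_of_resTorsion_values`;
consumers `…HalfTransverseLocalPackaged`, gk2-p4 `…RTDeepOwnPrimeCondition`) asks, over the Heegner field `K` at an own prime `λ ∣ ℓ ∣ m`
of the Kolyvagin product, that the value of `c_M(m)` at a Frobenius `F_λ` lie in the line of its value at the inertial generator: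
**`[c_M(m), F_λ] ∈ ℤ·[c_M(m), τ₀]`** — McCallum Prop. 4.4 (1) «`c_M(mℓ)_λ = χ_ℓ(P_m) ∈ im χ_ℓ`», i.e. the restricted cocycle factors
through `Gal(K_{m,λ_m}/K_λ) = ⟨σ_ℓ⟩`, whose proof rests on `P_m ∈ p^M E(K_{m,λ_m})` («`D_ℓ ≡ ℓ(ℓ+1)/2` on the residue field»).  The
route's Q2 `KolyvaginRelationAtTwo` AS TYPED carries only the two ORDER clauses of Prop. 4.4 («in particular»), from which (iii) does NOT
follow; so (iii) is proved here in the same displayed-datum style in which gk2-p2 g5 settled Q2's `p = 2` content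
(`zsmul_kolyvaginClass_mem_torsionLocalKer_iff_mem_selmerLocalKer_of_charpoly`), from a SUBSET of that theorem's data plus ONE extra
hypothesis: **`p^M ∣ t`** in the reduction `P̃_{mℓ} = t·φ(P̃_m)` (`t = ℓ(ℓ+1)/2`; at `p = 2` this is `2^{M+1} ∣ ℓ + 1`, index `≥ M + 1` — TRUE
at the DEEP own primes of the engine, FALSE in general: gk2-p2 noted that the order clauses need no extra depth; the transversality does).
* **`exists_h1Eval_kolyvaginClass_frob_eq_zsmul_tame_of_datum`** — from: `A₁` admissible with invariant `P₁ = P_{mℓ}`; the place `λ`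
  good, `λ ∤ p`; `F ∈ Γ_{K(E[p^M])}`; an additive reduction `red` (inertia-invariant, injective on `E[p^M]`) with `red ∘ F = φ² ∘ red`;
  `φ² = 1` on `B[p^M]`; `τ₀ ∈ I_𝔓` through which `F` acts on `A₁` (`F = τ₀^i` on `A₁`: `D_λ = I_λ` in `Gal(K_{mℓ}/K)`); the root
  `R₀ ∈ A₁`, `p^M R₀ = τ₀P₁ − P₁`; a `φ²`-fixed `P̃₂ ∈ B` (the reduction of `P_m`, `F P_m = P_m`) with `red P₁ = t·φ(P̃₂)`, `p^M ∣ t`.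
  CONCLUSION: `∃ k : ℤ, [c(P₁), F] = k·[c(P₁), τ₀]` (indeed `k = i`).  PROOF: both values are `p^M`-torsion
  (`smul_sub_sub_rootIn_mem`); `[c, F] = FQ − Q − Σ_{j<i} τ₀^j R₀` (`rootIn_pow_smul_sub`) reduces to `φ²(Q̃) − Q̃ − i·red R₀`, and
  `φ²(Q̃) = Q̃` because `Q̃ − (t/p^M)φ(P̃₂)` is `p^M`-torsion; `[c, τ₀] = τ₀Q − Q − R₀` reduces to `−red R₀`; so `[c,F] − i[c,τ₀]` is
  `p^M`-torsion with reduction `0`, hence `0` (`red` injective on `E[p^M]`).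
HONEST FRAMING: the datum (reduction mod `𝔓 ∣ λ`, Frobenius, Eichler–Shimura `y_{mℓ} ≡ Frob·y_m`, `D_ℓ ≡ ℓ(ℓ+1)/2`, ramification of
`λ` in ring class fields) is DISPLAYED, exactly as in the tree's Prop. 4.4 files — the tree holds it at no prime.  Closes nothing.
BSD is NOT proved by any of this.

References: [McCallumLMS1991] §4 Lemma 4.1, Prop. 4.4 (1) and proof (p. 305); [GrossLMS1991] §3 Prop. 3.7 (2), §4 (4.6), Prop. 6.2.
-/

set_option autoImplicit false
set_option linter.dupNamespace false -- tree convention: `Summit.BirchSwinnertonDyer.BirchSwinnertonDyer.Theorems` (summit = sub-problem)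

noncomputable section
open scoped Classical

namespace Summit.BirchSwinnertonDyer.BirchSwinnertonDyer.Theorems.GenusExact.TransverseIsotropy

open WeierstrassCurve NumberField IsDedekindDomain Field Finset
open Literature.NumberTheory.GaloisRepresentations Literature.NumberTheory.EllipticCurves
open Literature.NumberTheory.EllipticCurves.KolyvaginCocycle

universe u

variable {K : Type u} [Field K] [NumberField K] (W : WeierstrassCurve K) [W.IsElliptic]

/-- **McCallum Prop. 4.4 (1) at every `p`, from the reduction datum, with the extra depth displayed: the value of Kolyvagin's class
at the Frobenius of `K_λ` is a multiple of its tame value.**  See the module docstring for the data; conclusion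
`∃ k : ℤ, [c(P₁), F] = k·[c(P₁), τ₀]` — the hypothesis `hval` of `…RTHalfTransverseOfValues.halfTransverse_of_resTorsion_values`
(with `g₂ := F`, `σ₁ := τ₀`), hence input (iii) of LINE 18's index-`≥ 2` bottom-rung engine at a deep own prime.
[cite: McCallumLMS1991, §4 Prop. 4.4 (1) and proof] [cite: GrossLMS1991, Prop. 6.2 (2), §4 (4.6)] -/
theorem exists_h1Eval_kolyvaginClass_frob_eq_zsmul_tame_of_datum
    {p : ℕ} (hp : p.Prime) {M : ℕ}
    {hdiv : ∀ P : geomPoints W, ∃ Q : geomPoints W, ((p ^ M : ℕ) : ℤ) • Q = P}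
    {A₁ : AddSubgroup (geomPoints W)}
    (hA₁ : IsAdmissible (absoluteGaloisGroup K) A₁ ((p ^ M : ℕ) : ℤ))
    {P₁ : geomPoints W}
    (hP₁ : P₁ ∈ invPoints (absoluteGaloisGroup K) A₁ ((p ^ M : ℕ) : ℤ))
    -- the place `λ`
    {v : HeightOneSpectrum (𝓞 K)} (hgood : W.HasGoodReductionAt v) (hpv : (p : 𝓞 K) ∉ v.asIdeal)
    {𝔐 : Ideal (HeightOneSpectrum.localAbsIntegers v)} (h𝔐 : 𝔐 ∈ v.localPrimesAbove)
    {F : absoluteGaloisGroup K} (hFfix : F ∈ torsionFixing W ((p ^ M : ℕ) : ℤ))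
    -- the reduction datum at `𝔓`
    {B : Type*} [AddCommGroup B] (red : geomPoints W →+ B) (φ : B →+ B)
    (hredI : ∀ τ ∈ (v.primeBelow (closureEmb (K := K) (v.adicCompletion K)) 𝔐).inertia
      (absoluteGaloisGroup K), ∀ x : geomPoints W, red (τ • x) = red x)
    (hredF : ∀ x : geomPoints W, red (F • x) = φ (φ (red x)))
    (hred : ∀ x : geomPoints W, ((p ^ M : ℕ) : ℤ) • x = 0 → red x = 0 → x = 0)
    (hBn : ∀ b : B, ((p ^ M : ℕ) : ℤ) • b = 0 → φ (φ b) = b)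
    -- the Euler-system data at `λ`
    {τ₀ : absoluteGaloisGroup K}
    (hτ₀ : τ₀ ∈ (v.primeBelow (closureEmb (K := K) (v.adicCompletion K)) 𝔐).inertia
      (absoluteGaloisGroup K))
    (hFA₁ : ∃ i : ℕ, ∀ x ∈ A₁, F • x = (τ₀ ^ i) • x)
    {R₀ : geomPoints W} (hR₀A : R₀ ∈ A₁) (hR₀ : ((p ^ M : ℕ) : ℤ) • R₀ = τ₀ • P₁ - P₁)
    {P₂red : B} (hP₂φ : φ (φ P₂red) = P₂red)
    {t : ℤ} (ht : ((p ^ M : ℕ) : ℤ) ∣ t) (hP₁red : red P₁ = t • φ P₂red) :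
    ∃ k : ℤ, h1Eval W _ (kolyvaginClass W _ hdiv hA₁ P₁ hP₁) F =
      k • h1Eval W _ (kolyvaginClass W _ hdiv hA₁ P₁ hP₁) τ₀ := by
  set ι₀ := closureEmb (K := K) (v.adicCompletion K) with hι₀
  set 𝔓 := v.primeBelow ι₀ 𝔐 with h𝔓def
  have hn0 : ((p ^ M : ℕ) : ℤ) ≠ 0 := by exact_mod_cast pow_ne_zero M hp.ne_zero
  have hnv : ((((p ^ M : ℕ) : ℤ)) : 𝓞 K) ∉ v.asIdeal := by
    rw [Int.cast_natCast, Nat.cast_pow]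
    exact fun h ↦ hpv (v.isPrime.mem_of_pow_mem M h)
  have hvbad : v ∉ W.badPlaces (𝓞 K) := fun h ↦ h hgood
  have hτ₀fix : τ₀ ∈ torsionFixing W ((p ^ M : ℕ) : ℤ) := inertia_le_torsionFixing W hvbad hnv ι₀ h𝔐 hτ₀
  obtain ⟨Q, hQ⟩ := hdiv P₁
  obtain ⟨i, hi⟩ := hFA₁
  -- the root at `τ₀` is `R₀`; at `F = τ₀^i` it is `Σ_{j<i} τ₀^j R₀`
  have hroot : rootIn A₁ ((p ^ M : ℕ) : ℤ) (τ₀ • P₁ - P₁) = R₀ := rootIn_eq hA₁.eq_zero_of_zsmul hR₀A hR₀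
  have hrootF : rootIn A₁ ((p ^ M : ℕ) : ℤ) (F • P₁ - P₁) = ∑ j ∈ range i, τ₀ ^ j • R₀ := by
    rw [hi P₁ hP₁.1, rootIn_pow_smul_sub hA₁ hP₁ τ₀ i, hroot]
  -- `φ²` fixes `Q̃`
  have hφφQ : φ (φ (red Q)) = red Q := by
    obtain ⟨t', rfl⟩ := ht
    have hz : φ (φ (red Q - t' • φ P₂red)) = red Q - t' • φ P₂red := by
      refine hBn _ ?_
      rw [zsmul_sub, ← map_zsmul red, hQ, hP₁red, smul_smul]
      exact sub_self _
    have h1 : red Q = (red Q - t' • φ P₂red) + t' • φ P₂red := by abel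
    calc φ (φ (red Q)) = φ (φ ((red Q - t' • φ P₂red) + t' • φ P₂red)) := by rw [← h1]
      _ = φ (φ (red Q - t' • φ P₂red)) + t' • φ (φ (φ P₂red)) := by
          rw [map_add, map_add, map_zsmul, map_zsmul]
      _ = red Q := by rw [hz, hP₂φ, sub_add_cancel]
  refine ⟨(i : ℤ), ?_⟩
  rw [kolyvaginClass_eq_cls hA₁ hP₁ hQ]
  unfold KolyvaginCocycle.cls
  rw [h1Eval_oneCocycleClass W _ _ hFfix, h1Eval_oneCocycleClass W _ _ hτ₀fix]
  apply Subtype.ext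
  rw [AddSubgroupClass.coe_zsmul, coe_cocycle_apply, coe_cocycle_apply, hrootF, hroot]
  -- both sides are `p^M`-torsion with the same reduction
  have hVF : ((p ^ M : ℕ) : ℤ) • (F • Q - Q - ∑ j ∈ range i, τ₀ ^ j • R₀) = 0 := by
    have h := (mem_torsionBy_iff' ((p ^ M : ℕ) : ℤ) _).mp (smul_sub_sub_rootIn_mem hP₁ hQ F)
    rwa [hrootF] at h
  have hVτ : ((p ^ M : ℕ) : ℤ) • (τ₀ • Q - Q - R₀) = 0 := by
    have h := (mem_torsionBy_iff' ((p ^ M : ℕ) : ℤ) _).mp (smul_sub_sub_rootIn_mem hP₁ hQ τ₀)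
    rwa [hroot] at h
  rw [← sub_eq_zero]
  refine hred _ ?_ ?_
  · rw [zsmul_sub, hVF, smul_comm, hVτ, zsmul_zero, sub_self]
  · rw [map_sub, map_zsmul, map_sub, map_sub, map_sub, map_sub, hredF, hφφQ, sub_self, zero_sub, map_sum,
      sum_congr rfl fun j _ ↦ hredI _ (pow_mem hτ₀ j) R₀, sum_const, card_range, hredI τ₀ hτ₀ Q, sub_self, zero_sub,
      smul_neg, ← natCast_zsmul, sub_eq_zero]

end Summit.BirchSwinnertonDyer.BirchSwinnertonDyer.Theorems.GenusExact.TransverseIsotropy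

end
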